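import Summits.Ventures.GridStability.Lyapunov.RelativeLffClosedForm
import Summits.Ventures.GridStability.Models.LineAngleBounds
import HarnessLib

/-!
# GridStability/Lyapunov/RelativeLffClosedFormLines — the solver-free closed-form certificate on the
# 45-line (UNORDERED, full-weight) presentation, and EXPLICIT RATIONAL LEVELS from node-angle tables

Cell `gridfusion` (LADDER-GRIDFUSION), LFF lane (P1/P2 «explicit rational level», model-1 02:56:21Z /
03:17:53Z `Models/LineAngleBounds.lean` p491061, model-4 03:02:05Z level blocks); seat gridfusion-lyap-1 (g3);
namespace `Summit.Ventures.GridStability.Lyapunov.RelativeLff` (continued). GENERIC in `d : RecastData n`.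

1. `certU` — the closed-form member [cite: VuTuritsyn2016, §III eq. (QKH)] of `Lyapunov/RelativeLffClosedForm.lean`
   (Sherman–Morrison `N⁻¹`, scalar PSD criterion, `c = 1`, `g = λ/2`, `c′ = 2/λ + λ/2`) on model-1's
   UNORDERED-line presentation `d.lffSystemU lam δs` (p486010: lines `i < j`, full weights `w = C_ij`,
   lit-6's preferred presentation) — same matrices `N⁻¹`, only `E`, `w`, `δs` re-keyed; `wellU_…` /
   `synchronisationU_…` as before (bridge `RecastData.hasDerivWithinAt_lffState_lines`). On this
   presentation the admissible-level gap term `K_k·vtGap(δ*_k) = c′·C_ij·vtGap` is TWICE the ordered-pair one.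
2. EXPLICIT LEVELS. With lit-6's `Certificate.V_zero` (`V(0) = −Σ_k K_k (cos δ*_k + δ*_k sin δ*_k)`) and
   model-1's rational consumer bounds (`RecastData.vtGapLo_le_line`, `sum_w_eqTerm_le_line` from certified
   node tables `lo ≤ θ* ≤ hi`, `table_le_angleOf` / `angleOf_le_table`), the symbolic hypothesis
   `∀ k, c₀ < V(0) + K_k·vtGap(δ*_k)` follows from ONE rational number: for any nonnegative rational line
   weights `w` (`levelBoundQ d w lo hi k = −Σ_{k'} w_{k'}·eqTermHi_{k'} + w_k·vtGapLo_k`, `level_key`), any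
   rational `L ≤ levelBoundQ … k` for all `k` (per instance: `decide`), and `K = c′·w`: every `c₀ < c′·L` is
   admissible (`hc₀_of_level`). Packaged for `certU`: `wellU_subset_regionOfAttraction_of_level`,
   `synchronisationU_of_level` — hypotheses = instance scalars + node tables passing the decidable tests +
   `L` with its decidable inequality + `c₀ < (2/λ + λ/2)·L`.
THREE COLUMNS: theorem schema about MODEL M′ (lossless network-reduced classical model, uniform damping;
MV-2L + MV-λ, + MV-RD/MV-h12 per instance); CERTIFIED per instance = finitely many rational (in)equalities;
VALIDATED nothing. No sentence here says that any grid is stable. Definitions `certU`, `levelBoundQ`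
(bookkeeping); no named fact; standard axioms.
-/

noncomputable section

open Set Filter Topology Real Matrix Finset
open Literature.MathematicalPhysics.PowerSystems
open Literature.MathematicalPhysics.PowerSystems.LyapunovFunctionFamily
open Literature.MathematicalPhysics.PowerSystems.ClassicalModel.LosslessSystem (vtGap)
open Summit.Ventures.GridStability.Models

namespace Summit.Ventures.GridStability.Lyapunov.RelativeLff

variable {n : ℕ} (d : RecastData n)

/-! ### The closed form on the unordered-line presentation -/

/-- `d.lffSystemU lam δs` is lit-6's `relativeSwing` on `Mμ d`, `Mref d`, `lffEu`, `lffWu` (definitional). -/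
theorem lffSystemU_eq (lam : ℚ) (δs : Fin (n + 1) → ℝ) :
    d.lffSystemU lam δs = System.relativeSwing (Mμ d) (Mref d) (lam : ℝ) (RecastData.lffEu n)
      d.lffWu (RecastData.lffδsu δs) := rfl

/-- **The closed-form certificate on the 45-line presentation** (every `λ > 0`; `c = 1`, `g = λ/2`,
`c′ = 2/λ + λ/2`; full weights `w = C_ij > 0`). Type inferred (`= Certificate (d.lffSystemU lam δs)` by
`lffSystemU_eq`). [cite: VuTuritsyn2016, §III eq. (QKH)] -/
def certU (lam : ℚ) (hlam : 0 < lam) (δs : Fin (n + 1) → ℝ) {ν : ℝ} (hν : 0 < ν)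
    (hM : ∀ i, 0 < d.M i) (hνM : ∀ m, ν < Mμ d m) (hCS : ∑ m, Mμ d m ^ 2 / (Mμ d m - ν) ≤ S d)
    (hC : ∀ i j : Fin (n + 1), i ≠ j → 0 < d.Cc i j) :=
  Certificate.relativeClosedForm (Mμ d) (Mref d) (lam : ℝ) (RecastData.lffEu n) d.lffWu
    (RecastData.lffδsu δs) (Ninv d) 1 (2 / (lam : ℝ) + (lam : ℝ) / 2) ν ((lam : ℝ) / 2)
    (Ninv_mul d hM) (Ninv_transpose d) hν (Ninv_sub_posSemidef d hM hνM hCS) (d.lffWu_pos hC)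
    (by exact_mod_cast hlam) one_pos
    (by have : (0 : ℝ) < lam := by exact_mod_cast hlam
        positivity)
    (by have h : (0 : ℝ) < lam := by exact_mod_cast hlam
        rw [mul_add, mul_div_cancel₀ _ h.ne']; nlinarith)
    (by have : (0 : ℝ) < lam := by exact_mod_cast hlam
        positivity)
    (by have h : (0 : ℝ) < lam := by exact_mod_cast hlam
        linarith)
    (by have h : (0 : ℝ) < lam := by exact_mod_cast hlam
        have e : ((lam : ℝ) * 1 - (lam : ℝ) / 2) * (2 / (lam : ℝ) + (lam : ℝ) / 2 - (lam : ℝ) / 2) = 1 := by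
          field_simp; ring
        rw [e]; norm_num)

/-- Window lemma on unordered lines: angles in a window of width `≤ π/2` ⇒ `|θ*_i − θ*_j| < π/2`. -/
theorem abs_δsu_lt_of_window {δs : Fin (n + 1) → ℝ} {lo hi : ℝ} (hw : hi - lo ≤ π / 2)
    (hθ : ∀ i, lo ≤ δs i ∧ δs i < hi) (k : RecastData.LffLine n) :
    |RecastData.lffδsu δs k| < π / 2 := by
  show |δs k.1.1 - δs k.1.2| < π / 2
  have h1 := hθ k.1.1
  have h2 := hθ k.1.2
  rw [abs_lt]; constructor <;> linarith

/-- Acute data ⇒ `|θ*_i − θ*_j| < π/2` on every unordered line. -/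
theorem abs_δsu_lt_of_acute (hs : ∀ i, 0 ≤ d.s i) (hc : ∀ i, 0 < d.c i) (k : RecastData.LffLine n) :
    |RecastData.lffδsu d.angleOf k| < π / 2 :=
  abs_δsu_lt_of_window (lo := 0) (hi := π / 2) (by linarith)
    (fun i => angleOf_mem_of_acute d hs hc i) k

/-- **Certified region, unordered-line presentation** ([cite: VuTuritsyn2016, §IV set ℛ]): for every
`λ > 0`, instance input of `certU`, `|δ*_k| < π/2`, every level `c₀ < V(0) + c′·C_k·vtGap(δ*_k)` and every
`y ∈ 𝒫` with `V y ≤ c₀`: a global solution exists and EVERY global solution keeps `{𝒫, V ≤ c₀}` and tends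
to `0`. MODELLED: MV-2L + MV-λ. -/
theorem wellU_subset_regionOfAttraction (lam : ℚ) (hlam : 0 < lam) {δs : Fin (n + 1) → ℝ} {ν : ℝ}
    (hν : 0 < ν) (hM : ∀ i, 0 < d.M i) (hνM : ∀ m, ν < Mμ d m)
    (hCS : ∑ m, Mμ d m ^ 2 / (Mμ d m - ν) ≤ S d) (hC : ∀ i j : Fin (n + 1), i ≠ j → 0 < d.Cc i j)
    (hδs : ∀ k, |RecastData.lffδsu δs k| < π / 2) {c₀ : ℝ}
    (hc₀ : ∀ k, c₀ < (certU d lam hlam δs hν hM hνM hCS hC).V 0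
      + (2 / (lam : ℝ) + (lam : ℝ) / 2) * d.lffWu k * vtGap (RecastData.lffδsu δs k))
    {y : Fin n ⊕ Fin n → ℝ} (hy : y ∈ (d.lffSystemU lam δs).polytope)
    (hyc : (certU d lam hlam δs hν hM hνM hCS hC).V y ≤ c₀) :
    (∃ X : ℝ → Fin n ⊕ Fin n → ℝ, X 0 = y ∧
        ∀ T : ℝ, ∀ t ∈ Icc 0 T, HasDerivWithinAt X ((d.lffSystemU lam δs).field (X t)) (Icc 0 T) t) ∧
      ∀ X : ℝ → Fin n ⊕ Fin n → ℝ, X 0 = y →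
        (∀ T : ℝ, ∀ t ∈ Icc 0 T, HasDerivWithinAt X ((d.lffSystemU lam δs).field (X t)) (Icc 0 T) t) →
        (∀ t, 0 ≤ t → X t ∈ (d.lffSystemU lam δs).polytope ∧
            (certU d lam hlam δs hν hM hνM hCS hC).V (X t) ≤ c₀) ∧
          Tendsto X atTop (𝓝 0) := by
  rw [lffSystemU_eq] at hy ⊢
  exact Certificate.relativeClosedForm_well_subset_regionOfAttraction (Mμ d) (Mref d) (lam : ℝ)
    (RecastData.lffEu n) d.lffWu (RecastData.lffδsu δs) (Ninv d) 1 (2 / (lam : ℝ) + (lam : ℝ) / 2)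
    ν ((lam : ℝ) / 2) _ _ _ _ _ _ _ _ _ _ _ _ RecastData.lffEu_injective_aux hδs hc₀ hy hyc

/-- **The same read on the typed classical model** (lossless reciprocal data faithful at `δs`): every
solution of `d.toModelRel lam a′` on `univ` whose initial relative state lies in `{𝒫, V ≤ c₀}` keeps it and
has relative state `→ 0` (synchronisation with machine `0`). [cite: VuTuritsyn2016, §IV set ℛ;
SauerPai1998, §6.10 eqs. (6.238)–(6.241)] -/
theorem synchronisationU_of_isSolutionOn (lam : ℚ) (hlam : 0 < lam) (a : ℝ)
    (hG : ∀ i j, i ≠ j → d.G i j = 0) (hB : ∀ i j, d.B i j = d.B j i) {δs : Fin (n + 1) → ℝ}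
    (hEq : d.EqData δs) {ν : ℝ} (hν : 0 < ν) (hM : ∀ i, 0 < d.M i) (hνM : ∀ m, ν < Mμ d m)
    (hCS : ∑ m, Mμ d m ^ 2 / (Mμ d m - ν) ≤ S d) (hC : ∀ i j : Fin (n + 1), i ≠ j → 0 < d.Cc i j)
    (hδs : ∀ k, |RecastData.lffδsu δs k| < π / 2) {c₀ : ℝ}
    (hc₀ : ∀ k, c₀ < (certU d lam hlam δs hν hM hνM hCS hC).V 0
      + (2 / (lam : ℝ) + (lam : ℝ) / 2) * d.lffWu k * vtGap (RecastData.lffδsu δs k))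
    {c : ℝ → ClassicalSwing.State (n + 1)} (hc : (d.toModelRel lam a).IsSolutionOn c univ)
    (hy : RecastData.lffState δs (c 0) ∈ (d.lffSystemU lam δs).polytope)
    (hyc : (certU d lam hlam δs hν hM hνM hCS hC).V (RecastData.lffState δs (c 0)) ≤ c₀) :
    (∀ t, 0 ≤ t → RecastData.lffState δs (c t) ∈ (d.lffSystemU lam δs).polytope ∧
          (certU d lam hlam δs hν hM hνM hCS hC).V (RecastData.lffState δs (c t)) ≤ c₀) ∧
      Tendsto (fun t => RecastData.lffState δs (c t)) atTop (𝓝 0) := by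
  obtain ⟨-, hall⟩ := wellU_subset_regionOfAttraction d lam hlam hν hM hνM hCS hC hδs hc₀ hy hyc
  exact hall (fun t => RecastData.lffState δs (c t)) rfl fun T t _ =>
    (d.hasDerivWithinAt_lffState_lines lam a hG hB hEq (fun i => (hM i).ne') hc (mem_univ t)).mono
      (subset_univ (Icc 0 T))

/-! ### Explicit rational levels from node-angle tables -/

/-- The rational level functional of a line for rational weights `w` and node tables `lo ≤ θ* ≤ hi`:
`−Σ_{k'} w_{k'}·eqTermHi_{k'} + w_k·vtGapLo_k` (a lower bound of `(V(0) + K_k·vtGap(δ*_k))/c′` when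
`K = c′·w`). -/
def levelBoundQ (w : RecastData.LffLine n → ℚ) (lo hi : Fin (n + 1) → ℚ) (k : RecastData.LffLine n) : ℚ :=
  -(∑ k' : RecastData.LffLine n, w k' * d.eqTermHi lo hi k'.1.1 k'.1.2) + w k * d.vtGapLo lo hi k.1.1 k.1.2

/-- **Key inequality**: for acute exact data, certified node tables and nonnegative weights,
`levelBoundQ ≤ −Σ_{k'} w_{k'}(cos δ*_{k'} + δ*_{k'} sin δ*_{k'}) + w_k·vtGap(δ*_k)` (model-1's bounds summed). -/
theorem level_key (hE : d.EqData d.angleOf) (hc : ∀ i, 0 < d.c i) {lo hi : Fin (n + 1) → ℚ}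
    (hlo : ∀ i, (lo i : ℝ) ≤ d.angleOf i) (hhi : ∀ i, d.angleOf i ≤ (hi i : ℝ))
    (w : RecastData.LffLine n → ℚ) (hw : ∀ k, 0 ≤ w k) (k : RecastData.LffLine n) :
    ((levelBoundQ d w lo hi k : ℚ) : ℝ) ≤
      -(∑ k' : RecastData.LffLine n, (w k' : ℝ) * (cos (RecastData.lffδsu d.angleOf k')
          + RecastData.lffδsu d.angleOf k' * sin (RecastData.lffδsu d.angleOf k')))
        + (w k : ℝ) * vtGap (RecastData.lffδsu d.angleOf k) := by
  have h1 := d.sum_w_eqTerm_le_line hE hc hlo hhi w hw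
  have h2 := mul_le_mul_of_nonneg_left (d.vtGapLo_le_line hE hc hlo hhi k)
    (show (0 : ℝ) ≤ (w k : ℝ) by exact_mod_cast hw k)
  have e : ((levelBoundQ d w lo hi k : ℚ) : ℝ) =
      -((∑ k' : RecastData.LffLine n, w k' * d.eqTermHi lo hi k'.1.1 k'.1.2 : ℚ) : ℝ)
        + (w k : ℝ) * ((d.vtGapLo lo hi k.1.1 k.1.2 : ℚ) : ℝ) := by
    push_cast [levelBoundQ]; ring
  rw [e]
  linarith

/-- **From one rational to the symbolic level hypothesis**: if `K = c′·w` with `c′ > 0`, `L ≤ levelBoundQ_k`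
for all lines `k`, and `c₀ < c′·L`, then `c₀ < −Σ K(cos δ* + δ* sin δ*) + K_k·vtGap(δ*_k)` for all `k`. -/
theorem lt_gapLevel_of_level (hE : d.EqData d.angleOf) (hc : ∀ i, 0 < d.c i) {lo hi : Fin (n + 1) → ℚ}
    (hlo : ∀ i, (lo i : ℝ) ≤ d.angleOf i) (hhi : ∀ i, d.angleOf i ≤ (hi i : ℝ))
    (w : RecastData.LffLine n → ℚ) (hw : ∀ k, 0 ≤ w k) {c' : ℝ} (hc' : 0 < c') {L : ℚ}
    (hL : ∀ k, L ≤ levelBoundQ d w lo hi k) {c₀ : ℝ} (hc₀ : c₀ < c' * (L : ℝ))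
    (k : RecastData.LffLine n) :
    c₀ < -(∑ k' : RecastData.LffLine n, c' * (w k' : ℝ) * (cos (RecastData.lffδsu d.angleOf k')
          + RecastData.lffδsu d.angleOf k' * sin (RecastData.lffδsu d.angleOf k')))
        + c' * (w k : ℝ) * vtGap (RecastData.lffδsu d.angleOf k) := by
  have h1 := level_key d hE hc hlo hhi w hw k
  have hL' : ((L : ℚ) : ℝ) ≤ ((levelBoundQ d w lo hi k : ℚ) : ℝ) := by exact_mod_cast hL k
  have hs : ∑ k' : RecastData.LffLine n, c' * (w k' : ℝ) * (cos (RecastData.lffδsu d.angleOf k')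
          + RecastData.lffδsu d.angleOf k' * sin (RecastData.lffδsu d.angleOf k'))
      = c' * ∑ k' : RecastData.LffLine n, (w k' : ℝ) * (cos (RecastData.lffδsu d.angleOf k')
          + RecastData.lffδsu d.angleOf k' * sin (RecastData.lffδsu d.angleOf k')) := by
    rw [Finset.mul_sum]
    exact Finset.sum_congr rfl fun k' _ => by ring
  rw [hs]
  have h2 := mul_le_mul_of_nonneg_left (hL'.trans h1) hc'.le
  linarith

/-- The full line weights over `ℚ`: `w_k = C_ij`. -/
def wuq (k : RecastData.LffLine n) : ℚ := d.Cc k.1.1 k.1.2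

/-- `wuq` casts to `lffWu`. -/
theorem wuq_cast (k : RecastData.LffLine n) : ((wuq d k : ℚ) : ℝ) = d.lffWu k := rfl

/-- **The symbolic level hypothesis of `certU` discharged by ONE rational `L`**: node tables passing the
decidable tests, `L ≤ levelBoundQ (C) lo hi k` for every line, and `c₀ < (2/λ + λ/2)·L`. -/
theorem hc₀U_of_level (lam : ℚ) (hlam : 0 < lam) {ν : ℝ} (hν : 0 < ν) (hM : ∀ i, 0 < d.M i)
    (hνM : ∀ m, ν < Mμ d m) (hCS : ∑ m, Mμ d m ^ 2 / (Mμ d m - ν) ≤ S d)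
    (hC : ∀ i j : Fin (n + 1), i ≠ j → 0 < d.Cc i j) (hE : d.EqData d.angleOf)
    (hcirc : ∀ i, d.s i ^ 2 + d.c i ^ 2 = 1) (hs : ∀ i, 0 ≤ d.s i) (hc : ∀ i, 0 < d.c i)
    (lo hi : Fin (n + 1) → ℚ) (hlo : ∀ i, lo i ≤ 0 ∨ AngleEnclosure.lowerTest (d.c i) (lo i) = true)
    (hhi : ∀ i, (d.c i = 1 ∧ 0 ≤ hi i) ∨ AngleEnclosure.upperTest (d.c i) (hi i) = true)
    {L : ℚ} (hL : ∀ k, L ≤ levelBoundQ d (wuq d) lo hi k) {c₀ : ℝ}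
    (hc₀ : c₀ < (2 / (lam : ℝ) + (lam : ℝ) / 2) * (L : ℝ)) (k : RecastData.LffLine n) :
    c₀ < (certU d lam hlam d.angleOf hν hM hνM hCS hC).V 0
      + (2 / (lam : ℝ) + (lam : ℝ) / 2) * d.lffWu k * vtGap (RecastData.lffδsu d.angleOf k) := by
  have hlam' : (0 : ℝ) < lam := by exact_mod_cast hlam
  have hc' : (0 : ℝ) < 2 / (lam : ℝ) + (lam : ℝ) / 2 := by positivity
  have hw : ∀ k, 0 ≤ wuq d k := fun k => (hC k.1.1 k.1.2 (ne_of_lt k.2)).le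
  have h := lt_gapLevel_of_level d hE hc (d.table_le_angleOf hcirc hs lo hlo)
    (d.angleOf_le_table hcirc hs hi hhi) (wuq d) hw hc' hL hc₀ k
  rw [Certificate.V_zero]
  simp only [wuq_cast] at h
  exact h

/-- **Certified region with an EXPLICIT level** (unordered-line closed form): hypotheses = the instance
scalars of `certU`, lossless reciprocal faithful data, acute exact circle points, node tables passing the
decidable enclosure tests, a rational `L` below every `levelBoundQ`, and any `c₀ < (2/λ + λ/2)·L`;
conclusion = the region sentence of `wellU_subset_regionOfAttraction`. [cite: VuTuritsyn2016, §IV set ℛ] -/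
theorem wellU_subset_regionOfAttraction_of_level (lam : ℚ) (hlam : 0 < lam) {ν : ℝ} (hν : 0 < ν)
    (hM : ∀ i, 0 < d.M i) (hνM : ∀ m, ν < Mμ d m) (hCS : ∑ m, Mμ d m ^ 2 / (Mμ d m - ν) ≤ S d)
    (hC : ∀ i j : Fin (n + 1), i ≠ j → 0 < d.Cc i j) (hE : d.EqData d.angleOf)
    (hcirc : ∀ i, d.s i ^ 2 + d.c i ^ 2 = 1) (hs : ∀ i, 0 ≤ d.s i) (hc : ∀ i, 0 < d.c i)
    (lo hi : Fin (n + 1) → ℚ) (hlo : ∀ i, lo i ≤ 0 ∨ AngleEnclosure.lowerTest (d.c i) (lo i) = true)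
    (hhi : ∀ i, (d.c i = 1 ∧ 0 ≤ hi i) ∨ AngleEnclosure.upperTest (d.c i) (hi i) = true)
    {L : ℚ} (hL : ∀ k, L ≤ levelBoundQ d (wuq d) lo hi k) {c₀ : ℝ}
    (hc₀ : c₀ < (2 / (lam : ℝ) + (lam : ℝ) / 2) * (L : ℝ))
    {y : Fin n ⊕ Fin n → ℝ} (hy : y ∈ (d.lffSystemU lam d.angleOf).polytope)
    (hyc : (certU d lam hlam d.angleOf hν hM hνM hCS hC).V y ≤ c₀) :
    (∃ X : ℝ → Fin n ⊕ Fin n → ℝ, X 0 = y ∧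
        ∀ T : ℝ, ∀ t ∈ Icc 0 T,
          HasDerivWithinAt X ((d.lffSystemU lam d.angleOf).field (X t)) (Icc 0 T) t) ∧
      ∀ X : ℝ → Fin n ⊕ Fin n → ℝ, X 0 = y →
        (∀ T : ℝ, ∀ t ∈ Icc 0 T,
          HasDerivWithinAt X ((d.lffSystemU lam d.angleOf).field (X t)) (Icc 0 T) t) →
        (∀ t, 0 ≤ t → X t ∈ (d.lffSystemU lam d.angleOf).polytope ∧
            (certU d lam hlam d.angleOf hν hM hνM hCS hC).V (X t) ≤ c₀) ∧
          Tendsto X atTop (𝓝 0) :=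
  wellU_subset_regionOfAttraction d lam hlam hν hM hνM hCS hC (abs_δsu_lt_of_acute d hs hc)
    (hc₀U_of_level d lam hlam hν hM hνM hCS hC hE hcirc hs hc lo hi hlo hhi hL hc₀) hy hyc

/-- **Synchronisation with an EXPLICIT level** on the typed classical model (`G_ij = 0` off-diagonal,
`B` symmetric). [cite: VuTuritsyn2016, §IV set ℛ; SauerPai1998, §6.10] -/
theorem synchronisationU_of_level (lam : ℚ) (hlam : 0 < lam) (a : ℝ)
    (hG : ∀ i j, i ≠ j → d.G i j = 0) (hB : ∀ i j, d.B i j = d.B j i) {ν : ℝ} (hν : 0 < ν)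
    (hM : ∀ i, 0 < d.M i) (hνM : ∀ m, ν < Mμ d m) (hCS : ∑ m, Mμ d m ^ 2 / (Mμ d m - ν) ≤ S d)
    (hC : ∀ i j : Fin (n + 1), i ≠ j → 0 < d.Cc i j) (hE : d.EqData d.angleOf)
    (hcirc : ∀ i, d.s i ^ 2 + d.c i ^ 2 = 1) (hs : ∀ i, 0 ≤ d.s i) (hc : ∀ i, 0 < d.c i)
    (lo hi : Fin (n + 1) → ℚ) (hlo : ∀ i, lo i ≤ 0 ∨ AngleEnclosure.lowerTest (d.c i) (lo i) = true)
    (hhi : ∀ i, (d.c i = 1 ∧ 0 ≤ hi i) ∨ AngleEnclosure.upperTest (d.c i) (hi i) = true)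
    {L : ℚ} (hL : ∀ k, L ≤ levelBoundQ d (wuq d) lo hi k) {c₀ : ℝ}
    (hc₀ : c₀ < (2 / (lam : ℝ) + (lam : ℝ) / 2) * (L : ℝ))
    {c : ℝ → ClassicalSwing.State (n + 1)} (hsol : (d.toModelRel lam a).IsSolutionOn c univ)
    (hy : RecastData.lffState d.angleOf (c 0) ∈ (d.lffSystemU lam d.angleOf).polytope)
    (hyc : (certU d lam hlam d.angleOf hν hM hνM hCS hC).V (RecastData.lffState d.angleOf (c 0)) ≤ c₀) :
    (∀ t, 0 ≤ t → RecastData.lffState d.angleOf (c t) ∈ (d.lffSystemU lam d.angleOf).polytope ∧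
          (certU d lam hlam d.angleOf hν hM hνM hCS hC).V (RecastData.lffState d.angleOf (c t)) ≤ c₀) ∧
      Tendsto (fun t => RecastData.lffState d.angleOf (c t)) atTop (𝓝 0) :=
  synchronisationU_of_isSolutionOn d lam hlam a hG hB hE hν hM hνM hCS hC (abs_δsu_lt_of_acute d hs hc)
    (hc₀U_of_level d lam hlam hν hM hνM hCS hC hE hcirc hs hc lo hi hlo hhi hL hc₀) hsol hy hyc

end Summit.Ventures.GridStability.Lyapunov.RelativeLff

end
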